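import Summits.AnomalousDissipation.AnomalousDissipation.Theorems.ImpulseGridGridSignsCeilingsTransfer

/-!
# Crux `GridSigns` (stmt-AnomalousDissipation-1771) — the KICK BUDGET gives `GridSigns` (budget transfer)

Second transfer of line `SketchIdeator2` (lead c1), the DNS-facing form of the line's existence
hypothesis. By the landed kick formula (`stub_kickInjectionIdentity`, p114982) and detuned-work
identity (`detunedWorkIdentity`, p116272), the early-relaxation functional of `GridSigns` is
EXACTLY
`(b)ⱼ = −[c·Λ(χ⟪G,uⱼ⟫) + Λ(χw₀⟪G,uⱼ⟫) − Λ(Φw₀⟪G,uⱼ⟫) + Λ(H⟪wⱼ,(wⱼ·∇)G⟫)] − (∫ΦH)‖G‖₂²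
          + c·Λ(G,uⱼ) − νⱼ[Λ(uⱼ,Δ(HG)) + Λ(uⱼ,Δ(ΨG))]`,
so (b) holds with margin `2η` as soon as the five physically named first/second moments of the
wake obey a BUDGET against the free kick `(∫ΦH)‖G‖₂²`: returning-stream correlation
`c·Λ(χ⟪G,u⟫) ≥ −ρ₁`, window cross-moment `Λ(χw₀⟪G,u⟫) ≥ −ρ₂`, slab cross-moment
`Λ(Φw₀⟪G,u⟫) ≤ ρ₃`, arc production `Λ(H⟪w,(w·∇)G⟫) ≥ −ρ₄`, resonant response `c·Λ(G,u) ≤ ρₐ`,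
with `(∫ΦH)‖G‖₂² − ρ₁ − ρ₂ − ρ₃ − ρ₄ − ρₐ ≥ 2η` (`gridSigns_of_kickBudget`). Compared with the
ceilings transfer `gridSigns_of_quietWakes` (p116272) no Young/strain ENERGY ceilings are used:
the lead's toy DNS (kit j019000 smoke, j020100 sweep) shows the slab ceiling `Gmax·Λ∫Φ|w|²`
alone exceeds the kick in the impulsive regime (the fresh imprint `ΨG/c` behind the slab has
energy density `≈ A²` there), while the actual cross-moment `Λ(Φw₀⟪G,u⟫)` is two orders of
magnitude smaller — the smallness is decorrelation, not quietness. The `O(ν)` Laplacian pairings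
are again absorbed by a tail shift through `stub_laplacianPairingBound`. No new definitions.
-/

noncomputable section

-- `Summit.<Summit>.<Problem>` is the tree's mandated summit-side namespace (CONVENTIONS §2); for this
-- single-conjunct summit the two coincide, so the duplicate is deliberate.
set_option linter.dupNamespace false

open MeasureTheory Set Filter Topology
open scoped InnerProductSpace RealInnerProductSpace

namespace Summit.AnomalousDissipation.AnomalousDissipation.Theorems.GridSignsCeilings

open Literature.Analysis
open Literature.Analysis.FluidPDE Literature.Analysis.FluidPDE.Torus
open Literature.Analysis.FunctionSpaces Literature.Analysis.FunctionSpaces.Torus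
open Summit.AnomalousDissipation.AnomalousDissipation.Theses.ImpulseGrid

/-- **The kick budget gives `GridSigns`** (line `SketchIdeator2`, budget transfer; DNS-facing form
of the existence bet). If a grid design with window `χ` and kick test function `H`
(`∂₀H = χ − Φ`) carries a bounded-energy drift Leray–Hopf family with NO REVERSAL and whose
returning-stream correlation, window/slab cross-moments, arc production and resonant response
obey `(∫ΦH)‖G‖₂² − ρ₁ − ρ₂ − ρ₃ − ρ₄ − ρₐ ≥ 2η` in one generalized limit, then `GridSigns` holds
(with `η`, along a tail of the family). [folklore] -/
theorem gridSigns_of_kickBudget :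
    (∃ (Φ Ψ χ H : UnitAddTorus (Fin 3) → ℝ) (G : UnitAddTorus (Fin 3) → EuclideanSpace ℝ (Fin 3))
      (c ρ₁ ρ₂ ρ₃ ρ₄ ρₐ η : ℝ),
      IsSmooth Φ ∧ IsSmooth Ψ ∧ IsSmooth G ∧
      (∀ (s : UnitAddCircle) x, Ψ (x + Pi.single (1 : Fin 3) s) = Ψ x ∧ Ψ (x + Pi.single (2 : Fin 3) s) = Ψ x) ∧
      (∀ (s : UnitAddCircle) x, G (x + Pi.single (0 : Fin 3) s) = G x) ∧ (∀ x, G x 0 = 0) ∧ IsDivFree G ∧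
      (∀ x, Torus.partialDeriv 0 Ψ x = Φ x - 1) ∧ (∫ x, Φ x * Ψ x * ‖G x‖ ^ 2 = 0) ∧
      IsSmooth (fun x => Φ x • G x) ∧ IsDivFree (fun x => Φ x • G x) ∧ HasZeroMean (fun x => Φ x • G x) ∧
      IsSmooth χ ∧ IsSmooth H ∧
      (∀ (s : UnitAddCircle) x, Φ (x + Pi.single (1 : Fin 3) s) = Φ x ∧ Φ (x + Pi.single (2 : Fin 3) s) = Φ x) ∧
      (∀ (s : UnitAddCircle) x, H (x + Pi.single (1 : Fin 3) s) = H x ∧ H (x + Pi.single (2 : Fin 3) s) = H x) ∧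
      (∀ x, Torus.partialDeriv 0 H x = χ x - Φ x) ∧
      0 < c ∧ 0 < η ∧
      2 * η ≤ (∫ x, Φ x * H x) * (∫ x, ‖G x‖ ^ 2) - ρ₁ - ρ₂ - ρ₃ - ρ₄ - ρₐ ∧
      ∃ (ν : ℕ → ℝ) (u₀ : ℕ → UnitAddTorus (Fin 3) → EuclideanSpace ℝ (Fin 3))
        (u : ℕ → ℝ → UnitAddTorus (Fin 3) → EuclideanSpace ℝ (Fin 3)) (Λ : GeneralizedLimit),
        (∀ j, 0 < ν j) ∧ Tendsto ν atTop (nhds 0) ∧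
        (∀ j, IsGlobalLerayHopf (ν j) (fun _ => fun x => Φ x • G x) (u₀ j) (u j)) ∧
        (∀ j, ∃ C : ℝ, ∀ t : ℝ, 0 ≤ t → kineticEnergy (u j t) ≤ C) ∧
        (∀ j, ∫ x, u₀ j x = c • EuclideanSpace.single 0 1) ∧
        (∃ E : ℝ, ∀ j, meanEnergy (u j) ≤ E) ∧
        (∀ j, 0 ≤ Λ.longTimeAvg (fun t => ∫ x, ⟪G x, u j t x⟫)) ∧
        (∀ j, c * Λ.longTimeAvg (fun t => ∫ x, ⟪G x, u j t x⟫) ≤ ρₐ) ∧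
        (∀ j, -ρ₁ ≤ c * Λ.longTimeAvg (fun t => ∫ x, χ x * ⟪G x, u j t x⟫)) ∧
        (∀ j, -ρ₂ ≤ Λ.longTimeAvg (fun t => ∫ x, χ x * ((u j t x - c • EuclideanSpace.single 0 1 : EuclideanSpace ℝ (Fin 3)) 0 * ⟪G x, u j t x⟫))) ∧
        (∀ j, Λ.longTimeAvg (fun t => ∫ x, Φ x * ((u j t x - c • EuclideanSpace.single 0 1 : EuclideanSpace ℝ (Fin 3)) 0 * ⟪G x, u j t x⟫)) ≤ ρ₃) ∧
        (∀ j, -ρ₄ ≤ Λ.longTimeAvg (fun t => ∫ x, H x * ⟪u j t x - c • EuclideanSpace.single 0 1,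
              Torus.convect (fun y => u j t y - c • EuclideanSpace.single 0 1) G x⟫))) →
    GridSigns := by
  intro hQ
  obtain ⟨Φ, Ψ, χ, H, G, c, ρ₁, ρ₂, ρ₃, ρ₄, ρₐ, η, hΦ, hΨ, hG, hΨinv, hGinv, hG0, hGdiv,
    hΨ', hnorm, hf1, hf2, hf3, hχ, hH, hΦinv, hHinv, hH', hc, hη,
    hmargin, ν, u₀, u, Λ, hν, hν0, hLH, hsup, hmom, ⟨E₀, hE₀⟩, hares, hρa, hρ1, hρ2, hρ3, hρ4⟩ := hQ
  -- the free kick factorizes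
  have hfact : ∫ x, Φ x * H x * ‖G x‖ ^ 2 = (∫ x, Φ x * H x) * ∫ x, ‖G x‖ ^ 2 :=
    stub_slabFactorization (fun x => Φ x * H x) G (hΦ.continuous.mul hH.continuous) hG.continuous
      (fun s x => ⟨by rw [(hΦinv s x).1, (hHinv s x).1], by rw [(hΦinv s x).2, (hHinv s x).2]⟩) hGinv
  -- a nonnegative energy ceiling
  set E : ℝ := max E₀ 0 with hEdef
  have hE : ∀ j, meanEnergy (u j) ≤ E := fun j => (hE₀ j).trans (le_max_left _ _)
  have hEnn : 0 ≤ E := le_max_right _ _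
  -- uniform bounds on the two Laplacian pairings
  have hV : IsSmooth (fun y => Ψ y • G y) := hΨ.smul' hG
  have hW : IsSmooth (fun y => H y • G y) := hH.smul' hG
  obtain ⟨MΨ, hMΨ0, hMΨ⟩ :=
    FluidPDE.Torus.exists_nonneg_forall_norm_le_of_continuous hV.laplacian.continuous
  obtain ⟨MH, hMH0, hMH⟩ :=
    FluidPDE.Torus.exists_nonneg_forall_norm_le_of_continuous hW.laplacian.continuous
  set K : ℝ := (MΨ + MH) * (1 + E) / 2 with hKdef
  have hK : 0 ≤ K := by positivity
  have hLΨ : ∀ j, |Λ.longTimeAvg (fun t => ∫ x, ⟪u j t x, Torus.laplacian (fun y => Ψ y • G y) x⟫)|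
      ≤ MΨ * (1 + E) / 2 := fun j => by
    have h := stub_laplacianPairingBound Λ (ν j) MΨ (fun x => Φ x • G x) (fun y => Ψ y • G y) (u₀ j)
      (u j) hV hMΨ (hLH j) (hsup j)
    have h2 : MΨ * (1 + meanEnergy (u j)) / 2 ≤ MΨ * (1 + E) / 2 := by
      have := hE j
      gcongr
    exact h.trans h2
  have hLHp : ∀ j, |Λ.longTimeAvg (fun t => ∫ x, ⟪u j t x, Torus.laplacian (fun y => H y • G y) x⟫)|
      ≤ MH * (1 + E) / 2 := fun j => by
    have h := stub_laplacianPairingBound Λ (ν j) MH (fun x => Φ x • G x) (fun y => H y • G y) (u₀ j)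
      (u j) hW hMH (hLH j) (hsup j)
    have h2 : MH * (1 + meanEnergy (u j)) / 2 ≤ MH * (1 + E) / 2 := by
      have := hE j
      gcongr
    exact h.trans h2
  -- choose the tail: `ν j · K ≤ η` for `j ≥ J`
  have hε : 0 < η / (K + 1) := by positivity
  obtain ⟨J, hJ⟩ := eventually_atTop.1 (hν0.eventually (gt_mem_nhds hε))
  have hsmall : ∀ j, J ≤ j → ν j * K ≤ η := by
    intro j hj
    have h1 : ν j < η / (K + 1) := hJ j hj
    have h2 : ν j * K ≤ ν j * (K + 1) := mul_le_mul_of_nonneg_left (by linarith) (hν j).le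
    have h3 : ν j * (K + 1) < η / (K + 1) * (K + 1) := mul_lt_mul_of_pos_right h1 (by linarith)
    have h4 : η / (K + 1) * (K + 1) = η := by field_simp
    linarith
  refine ⟨Φ, Ψ, G, c, η, Λ, hΦ, hΨ, hG, hΨinv, hGinv, hG0, hGdiv, hΨ', hnorm, hf1, hf2, hf3, hc, hη,
    fun j => ν (j + J), fun j => u₀ (j + J), fun j => u (j + J), fun j => hν _,
    hν0.comp (tendsto_add_atTop_nat J), fun j => hLH _, fun j => hmom _, ⟨E, fun j => hE _⟩,
    fun j => hares _, fun j => ?_⟩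
  -- (b) early relaxation with margin `η` along the tail
  beta_reduce
  set i := j + J with hidef
  have hS1 := detunedWorkIdentity Λ (ν i) c Φ Ψ G (u₀ i) (u i) (hν i) hΦ hΨ hG hΨinv hGinv hG0
    hGdiv hΨ' hnorm (hLH i) (hsup i)
  have hS2 := stub_kickInjectionIdentity Λ (ν i) c Φ χ H G (u₀ i) (u i) (hν i) hΦ hχ hH hG hHinv
    hGinv hG0 hGdiv hH' (hLH i) (hsup i)
  have b1 := hρ1 i; have b2 := hρ2 i; have b3 := hρ3 i; have b4 := hρ4 i; have ba := hρa i
  -- abbreviations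
  set B := Λ.longTimeAvg (fun t => ∫ x, ⟪u i t x - c • EuclideanSpace.single 0 1,
      Torus.convect (fun y => u i t y - c • EuclideanSpace.single 0 1) (fun y => Ψ y • G y) x⟫) with hBdef
  set F := Λ.longTimeAvg (fun t => ∫ x, ⟪Φ x • G x, u i t x⟫) with hFdef
  set A := Λ.longTimeAvg (fun t => ∫ x, ⟪G x, u i t x⟫) with hAdef
  set LΨ := Λ.longTimeAvg (fun t => ∫ x, ⟪u i t x, Torus.laplacian (fun y => Ψ y • G y) x⟫) with hLΨdef
  set LH' := Λ.longTimeAvg (fun t => ∫ x, ⟪u i t x, Torus.laplacian (fun y => H y • G y) x⟫) with hLHdef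
  set T1 := Λ.longTimeAvg (fun t => ∫ x, χ x * ⟪G x, u i t x⟫) with hT1
  set T2 := Λ.longTimeAvg (fun t => ∫ x, χ x * ((u i t x - c • EuclideanSpace.single 0 1 : EuclideanSpace ℝ (Fin 3)) 0 * ⟪G x, u i t x⟫))
    with hT2
  set T3 := Λ.longTimeAvg (fun t => ∫ x, Φ x * ((u i t x - c • EuclideanSpace.single 0 1 : EuclideanSpace ℝ (Fin 3)) 0 * ⟪G x, u i t x⟫))
    with hT3
  set T4 := Λ.longTimeAvg (fun t => ∫ x, H x * ⟪u i t x - c • EuclideanSpace.single 0 1,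
      Torus.convect (fun y => u i t y - c • EuclideanSpace.single 0 1) G x⟫) with hT4
  -- `ν`-terms
  have hν1 : |ν i * LΨ| ≤ ν i * (MΨ * (1 + E) / 2) := by
    rw [abs_mul, abs_of_pos (hν i)]
    exact mul_le_mul_of_nonneg_left (hLΨ i) (hν i).le
  have hν2 : |ν i * LH'| ≤ ν i * (MH * (1 + E) / 2) := by
    rw [abs_mul, abs_of_pos (hν i)]
    exact mul_le_mul_of_nonneg_left (hLHp i) (hν i).le
  have hν3 : ν i * K ≤ η := hsmall i (Nat.le_add_left J j)
  have hν4 := neg_abs_le (ν i * LΨ)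
  have hν5 := neg_abs_le (ν i * LH')
  have hKi : ν i * (MΨ * (1 + E) / 2) + ν i * (MH * (1 + E) / 2) = ν i * K := by
    rw [hKdef]; ring
  -- combine: `B = -c (F - A) - ν LΨ`, `c F = c T1 + T2 - T3 + T4 + ν LH' + ∫ΦH‖G‖²`, the budget
  linarith

end Summit.AnomalousDissipation.AnomalousDissipation.Theorems.GridSignsCeilings

end
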